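import Summits.SmoothPoincare4.SmoothPoincare4.Theorems.EinsteinBulkPEFillNearRoundRoundFilled
import Summits.SmoothPoincare4.SmoothPoincare4.Theorems.EinsteinBulkPEFillNearRoundRfgConstantCurvature
import Summits.SmoothPoincare4.SmoothPoincare4.Theorems.EinsteinBulkPEFillNearRoundRfgKillingHopfIsometry
import Summits.SmoothPoincare4.SmoothPoincare4.Theorems.EinsteinBulkPEFillNearRoundRfgTransport
import Literature.Geometry.Riemannian.ConformallyCompactFilling
import Literature.AlgebraicTopology.FundamentalGroup.SphereSimplyConnected
import Literature.Geometry.Lorentzian.LeviCivitaProofs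

/-!
# A ROUND metric on any closed 4-manifold diffeomorphic to `S⁴` bounds a Poincaré–Einstein 5-manifold
# (= the registered `stub_roundFilled` / `RoundFilled` of item stmt-SmoothPoincare4-18033 `PEFillStandardSphere`,
# the base point of the continuity method; registered helper `helper_roundFilledGeneral` of crux
# stmt-SmoothPoincare4-7997 `PEFillNearRound`, line `Sketch`)

Composition of the landed pieces:

* `helper_rfg_roundPackage` — the filling of `(S⁴, g_round)` itself: hyperbolic 5-space compactified on the
  closed 5-ball (the pieces `helper_rf_*` of `EinsteinBulkPEFillNearRoundRoundFilled.lean`, item 8003, now with the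
  boundary metric fixed to the round metric rather than existentially quantified);
* `helper_rfg_constantCurvature` — sectional curvature `≡ 1` on orthonormal pairs determines `Rm = (g∧g)/2`
  (Lee 2018, Prop. 8.36);
* `helper_rfg_killingHopfIsometry` — Killing–Hopf (Lee 2018, Thm. 12.4) with the isometry retained: a compact
  simply connected `4`-manifold of constant curvature `1` admits an isometric diffeomorphism from the round `S⁴`
  (`M ≅ S⁴` is simply connected: `simplyConnectedSpace_euclideanSphere`);
* `helper_rfg_transport` — a PE filling is transported along an isometric diffeomorphism of the boundary.

References: J. M. Lee, *Introduction to Riemannian Manifolds* (2018), Thm. 3.7 (c), Prop. 8.36, Thm. 12.4;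
G. Li, J. Qing, Y. Shi, Trans. AMS 369 (2017), Def. 2.1, Thm. 1.7.
-/

noncomputable section

-- the prescribed namespace `Summit.<P>.<Sub>.…` duplicates `SmoothPoincare4` (P = Sub)
set_option linter.dupNamespace false

open scoped Manifold ContDiff Topology RealInnerProductSpace ContinuousMap
open Set Function Metric Bundle TopologicalSpace
open Literature.Geometry.Lorentzian Literature.Geometry.Lorentzian.PseudoRiemannianMetric
open Literature.Geometry.Riemannian Literature.Topology.FourManifolds

namespace Summit.SmoothPoincare4.SmoothPoincare4.Cruxes.PEFillNearRound.RoundFilled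

/-- **The round `S⁴` with its ROUND metric bounds hyperbolic `5`-space** — the conformally compact Einstein
package of item 8003 with the boundary metric fixed to `g_round` (conformal factor `φ ≡ 1`): bulk
`(ℝ⁵, g_ℍ)` in the hyperboloid graph chart, `X̄ = 𝔻⁵`, `j = ballMap`, `ρ = (1 - ‖x‖²)/2`, `ḡ = |dx|²`
(Lee 2018, Thm. 3.7 (c); Li–Qing–Shi 2017, Def. 2.1 and Thm. 1.7). -/
theorem helper_rfg_roundPackage :
    (∃ (N : Type) (_ : TopologicalSpace N) (_ : T2Space N) (_ : SecondCountableTopology N) (_ : ChartedSpace (EuclideanSpace ℝ (Fin 5)) N) (_ : IsManifold (𝓡 5) ∞ N) (g : Bundle.ContMDiffRiemannianMetric (𝓡 5) ∞ (EuclideanSpace ℝ (Fin 5)) (TangentSpace (𝓡 5) : N → Type _)) (_ : (Literature.Geometry.Lorentzian.PseudoRiemannianMetric.ofRiemannian g).HasLeviCivita), (∀ x, (Literature.Geometry.Lorentzian.PseudoRiemannianMetric.ofRiemannian g).ricci x = (-4 : ℝ) • (Literature.Geometry.Lorentzian.PseudoRiemannianMetric.ofRiemannian g).toBilinForm x) ∧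 (∃ (X : Type) (_ : TopologicalSpace X) (_ : T2Space X) (_ : SecondCountableTopology X) (_ : ChartedSpace (EuclideanHalfSpace 5) X) (_ : IsManifold (𝓡∂ 5) ∞ X) (_ : CompactSpace X) (_ : ConnectedSpace X) (j : N → X) (ι : ↥(Metric.sphere (0 : EuclideanSpace ℝ (Fin 5)) 1) → X) (ρ : X → ℝ) (gb : Bundle.ContMDiffRiemannianMetric (𝓡∂ 5) 2 (EuclideanSpace ℝ (Fin 5)) (TangentSpace (𝓡∂ 5) : X → Type _)), Manifold.IsSmoothEmbedding (𝓡 5) (𝓡∂ 5) ∞ j ∧ Set.range j = (𝓡∂ 5).interior X ∧ Manifold.IsSmoothEmbedding (𝓡 4) (𝓡∂ 5) ∞ ι ∧ Set.range ι = (𝓡∂ 5).boundary X ∧ ContMDiff (𝓡∂ 5) 𝓘(ℝ, ℝ) ∞ ρ ∧ (∀ x : X, 0 ≤ ρ x) ∧ (∀ x : X, ρ x = 0 ↔ x ∈ (𝓡∂ 5).boundary X) ∧ (∀ y : ↥(Metric.sphere (0 : EuclideanSpace ℝ (Fin 5)) 1), ∃ ν : TangentSpace (𝓡∂ 5) (ι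 y), gb.inner (ι y) ν ν = 1 ∧ ∀ v : TangentSpace (𝓡∂ 5) (ι y), gb.inner (ι y) ν v = mfderiv (𝓡∂ 5) 𝓘(ℝ, ℝ) ρ (ι y) v) ∧ (∀ (x : N) (v w : TangentSpace (𝓡 5) x), gb.inner (j x) (mfderiv (𝓡 5) (𝓡∂ 5) j x v) (mfderiv (𝓡 5) (𝓡∂ 5) j x w) = ρ (j x) ^ 2 * g.inner x v w) ∧ (∃ φ : ↥(Metric.sphere (0 : EuclideanSpace ℝ (Fin 5)) 1) → ℝ, ∀ y : ↥(Metric.sphere (0 : EuclideanSpace ℝ (Fin 5)) 1), 0 < φ y ∧ ∀ v w : TangentSpace (𝓡 4) y, gb.inner (ι y) (mfderiv (𝓡 4) (𝓡∂ 5) ι y v) (mfderiv (𝓡 4) (𝓡∂ 5) ι y w) = φ y * ((@Literature.Geometry.Riemannian.roundMetric (EuclideanSpace ℝ (Fin 5)) _ _ 4 (Literature.Topology.FourManifolds.fact_finrank_euclideanSpace_succ 4)).toContMDiffRiemannianMetric (@Literature.Geometry.Riemannian.isRiemannian_roundMetric (EuclideanSpace ℝ (Fin 5)) _ _ 4 (Literature.Topology.FourManifolds.fact_finrank_euclideanSpace_succ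 4))).inner y v w))) := by
  -- the data
  haveI hLC : (Hyperboloid.metric (⊤ : TopologicalSpace.Opens (EuclideanSpace ℝ (Fin 5)))).HasLeviCivita :=
    (Hyperboloid.metric (⊤ : TopologicalSpace.Opens (EuclideanSpace ℝ (Fin 5)))).hasLeviCivita
  set G := Hyperboloid.metric (⊤ : TopologicalSpace.Opens (EuclideanSpace ℝ (Fin 5))) with hG
  set g : Bundle.ContMDiffRiemannianMetric (𝓡 5) ∞ (EuclideanSpace ℝ (Fin 5))
      (TangentSpace (𝓡 5) : ↥(⊤ : TopologicalSpace.Opens (EuclideanSpace ℝ (Fin 5))) → Type _) :=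
    G.toContMDiffRiemannianMetric Hyperboloid.isRiemannian_metric with hg
  haveI hLC' : (PseudoRiemannianMetric.ofRiemannian g).HasLeviCivita := hLC
  obtain ⟨hRic, -⟩ := @helper_rf_bulk hLC
  obtain ⟨gb, hgb⟩ := helper_rf_compactifiedMetric
  haveI : CompactSpace (Metric.closedBall (0 : EuclideanSpace ℝ (Fin 5)) 1) :=
    isCompact_iff_compactSpace.1 (isCompact_closedBall _ _)
  haveI : ConnectedSpace (Metric.closedBall (0 : EuclideanSpace ℝ (Fin 5)) 1) :=
    isConnected_iff_connectedSpace.1 ((convex_closedBall (0 : EuclideanSpace ℝ (Fin 5)) 1).isConnected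
      ⟨0, Metric.mem_closedBall_self zero_le_one⟩)
  refine ⟨↥(⊤ : TopologicalSpace.Opens (EuclideanSpace ℝ (Fin 5))), inferInstance, inferInstance, inferInstance,
    inferInstance, inferInstance, g, hLC', fun x => hRic x, ?_⟩
  refine ⟨(Metric.closedBall (0 : EuclideanSpace ℝ (Fin 5)) 1), inferInstance, inferInstance, inferInstance,
    inferInstance, inferInstance, inferInstance, inferInstance,
    (fun u : ↥(⊤ : TopologicalSpace.Opens (EuclideanSpace ℝ (Fin 5))) => (⟨Hyperboloid.ballMap (u : EuclideanSpace ℝ (Fin 5)),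
        mem_closedBall_zero_iff.2 (Hyperboloid.norm_ballMap_lt_one (u : EuclideanSpace ℝ (Fin 5))).le⟩ :
        (Metric.closedBall (0 : EuclideanSpace ℝ (Fin 5)) 1))),
    Set.inclusion (sphere_subset_closedBall : (Metric.sphere (0 : EuclideanSpace ℝ (Fin 5)) 1) ⊆
      (Metric.closedBall (0 : EuclideanSpace ℝ (Fin 5)) 1)),
    (fun x : (Metric.closedBall (0 : EuclideanSpace ℝ (Fin 5)) 1) => Hyperboloid.ballDefFn (x : EuclideanSpace ℝ (Fin 5))),
    gb, helper_rf_interiorEmbedding.1, helper_rf_interiorEmbedding.2,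
    helper_rf_boundaryEmbedding.1, helper_rf_boundaryEmbedding.2,
    helper_rf_definingFunction.1, helper_rf_definingFunction.2.1, helper_rf_definingFunction.2.2,
    helper_rf_unitNormal gb hgb, ?_, ⟨fun _ => 1, fun y => ⟨one_pos, fun v w => ?_⟩⟩⟩
  · intro x v w
    rw [helper_rf_conformal gb hgb x v w]
  · rw [one_mul]
    exact helper_rf_conformalInfinity gb hgb y v w

/-- **ROUND CLASSES ARE FILLED on manifolds diffeomorphic to `S⁴`** (`ValleyContinuity.RoundFilled`, the
registered `stub_roundFilled` of item stmt-SmoothPoincare4-18033, unfolded): on a closed smooth `M ≅ S⁴`, a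
`C^∞` metric whose sectional curvatures on orthonormal pairs are all `1` is the conformal infinity of a
`C²`-conformally compact Einstein (`Ric = -4g`) 5-manifold with `|dρ|_ḡ = 1`. Proof: `M` is simply connected
(diffeomorphic to `S⁴`); `K ≡ 1` is the tensor identity `Rm = (g∧g)/2` (`helper_rfg_constantCurvature`);
Killing–Hopf gives an isometric diffeomorphism `Φ : (S⁴, g_round) → (M, g)` (`helper_rfg_killingHopfIsometry`);
the hyperbolic filling of the round `S⁴` (`helper_rfg_roundPackage`) is transported along `Φ`
(`helper_rfg_transport`). [cite: Lee2018, Thm. 12.4] [cite: LiQingShi2017, Thm. 1.7] -/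
theorem helper_roundFilledGeneral :
    ∀ (M : Type) [TopologicalSpace M] [T2Space M] [SecondCountableTopology M] [ChartedSpace (EuclideanSpace ℝ (Fin 4)) M] [IsManifold (𝓡 4) ∞ M] [CompactSpace M] [ConnectedSpace M] [MeasurableSpace M] [BorelSpace M], Nonempty (M ≃ₘ⟮𝓡 4, 𝓡 4⟯ ↥(Metric.sphere (0 : EuclideanSpace ℝ (Fin 5)) 1)) → ∀ (g4 : Bundle.ContMDiffRiemannianMetric (𝓡 4) ∞ (EuclideanSpace ℝ (Fin 4)) (TangentSpace (𝓡 4) : M → Type _)) [_i : (Literature.Geometry.Lorentzian.PseudoRiemannianMetric.ofRiemannian g4).HasLeviCivita], (∀ (x : M) (X Y : TangentSpace (𝓡 4) x), g4.inner x X X = 1 → g4.inner x Y Y = 1 → g4.inner x X Y = 0 → (Literature.Geometry.Lorentzian.PseudoRiemannianMetric.ofRiemannian g4).curvatureForm (Literature.Geometry.Lorentzian.PseudoRiemannianMetric.ofRiemannian g4).leviCivita x X Y Y X = 1) → (∃ (N : Type) (_ : TopologicalSpace N) (_ : T2Space N) (_ : SecondCountableTopology N) (_ : ChartedSpace (EuclideanSpace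 ℝ (Fin 5)) N) (_ : IsManifold (𝓡 5) ∞ N) (g : Bundle.ContMDiffRiemannianMetric (𝓡 5) ∞ (EuclideanSpace ℝ (Fin 5)) (TangentSpace (𝓡 5) : N → Type _)) (_ : (Literature.Geometry.Lorentzian.PseudoRiemannianMetric.ofRiemannian g).HasLeviCivita), (∀ x, (Literature.Geometry.Lorentzian.PseudoRiemannianMetric.ofRiemannian g).ricci x = (-4 : ℝ) • (Literature.Geometry.Lorentzian.PseudoRiemannianMetric.ofRiemannian g).toBilinForm x) ∧ (∃ (X : Type) (_ : TopologicalSpace X) (_ : T2Space X) (_ : SecondCountableTopology X) (_ : ChartedSpace (EuclideanHalfSpace 5) X) (_ : IsManifold (𝓡∂ 5) ∞ X) (_ : CompactSpace X) (_ : ConnectedSpace X) (j : N → X) (ι : M → X) (ρ : X → ℝ) (gb : Bundle.ContMDiffRiemannianMetric (𝓡∂ 5) 2 (EuclideanSpace ℝ (Fin 5)) (TangentSpace (𝓡∂ 5) : X → Type _)), Manifold.IsSmoothEmbedding (𝓡 5) (𝓡∂ 5) ∞ j ∧ Set.range j = (𝓡∂ 5).interior X ∧ Manifold.IsSmoothEmbedding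 (𝓡 4) (𝓡∂ 5) ∞ ι ∧ Set.range ι = (𝓡∂ 5).boundary X ∧ ContMDiff (𝓡∂ 5) 𝓘(ℝ, ℝ) ∞ ρ ∧ (∀ x : X, 0 ≤ ρ x) ∧ (∀ x : X, ρ x = 0 ↔ x ∈ (𝓡∂ 5).boundary X) ∧ (∀ y : M, ∃ ν : TangentSpace (𝓡∂ 5) (ι y), gb.inner (ι y) ν ν = 1 ∧ ∀ v : TangentSpace (𝓡∂ 5) (ι y), gb.inner (ι y) ν v = mfderiv (𝓡∂ 5) 𝓘(ℝ, ℝ) ρ (ι y) v) ∧ (∀ (x : N) (v w : TangentSpace (𝓡 5) x), gb.inner (j x) (mfderiv (𝓡 5) (𝓡∂ 5) j x v) (mfderiv (𝓡 5) (𝓡∂ 5) j x w) = ρ (j x) ^ 2 * g.inner x v w) ∧ (∃ φ : M → ℝ, ∀ y : M, 0 < φ y ∧ ∀ v w : TangentSpace (𝓡 4) y, gb.inner (ι y) (mfderiv (𝓡 4) (𝓡∂ 5) ι y v) (mfderiv (𝓡 4) (𝓡∂ 5) ι y w) = φ y * g4.inner y v w))) := by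
  intro M _ _ _ _ _ _ _ _ _ hdiff g4 _ hround
  have hG : (PseudoRiemannianMetric.ofRiemannian g4).IsRiemannian := isRiemannian_ofRiemannian g4
  have hK : (PseudoRiemannianMetric.ofRiemannian g4).HasConstantSectionalCurvatureWith
      (PseudoRiemannianMetric.ofRiemannian g4).leviCivita 1 :=
    helper_rfg_constantCurvature M (PseudoRiemannianMetric.ofRiemannian g4) hG
      (fun x X Y hX hY hXY => hround x X Y hX hY hXY)
  -- `M ≅ S⁴` is simply connected
  obtain ⟨e⟩ := hdiff
  haveI : SimplyConnectedSpace (Metric.sphere (0 : EuclideanSpace ℝ (Fin (4 + 1))) 1) :=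
    Literature.AlgebraicTopology.FundamentalGroup.simplyConnectedSpace_euclideanSphere 4 (by norm_num)
  haveI : SimplyConnectedSpace M :=
    (e.toHomeomorph.toHomotopyEquiv).simplyConnectedSpace_iff.2 inferInstance
  -- Killing–Hopf with the isometry
  obtain ⟨Φ, hΦ⟩ := helper_rfg_killingHopfIsometry M (PseudoRiemannianMetric.ofRiemannian g4) hG hK
  -- the filling of the round sphere, in `IsPoincareEinsteinFilling` form
  have hpkg : ∃ (N : Type) (_ : TopologicalSpace N) (_ : T2Space N) (_ : SecondCountableTopology N)
      (_ : ChartedSpace (EuclideanSpace ℝ (Fin 5)) N) (_ : IsManifold (𝓡 5) ∞ N)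
      (g : Bundle.ContMDiffRiemannianMetric (𝓡 5) ∞ (EuclideanSpace ℝ (Fin 5)) (TangentSpace (𝓡 5) : N → Type _))
      (_ : (PseudoRiemannianMetric.ofRiemannian g).HasLeviCivita),
      IsPoincareEinsteinFilling (Metric.sphere (0 : EuclideanSpace ℝ (Fin 5)) 1)
        ((@roundMetric (EuclideanSpace ℝ (Fin 5)) _ _ 4 (fact_finrank_euclideanSpace_succ 4)).toContMDiffRiemannianMetric
          (@isRiemannian_roundMetric (EuclideanSpace ℝ (Fin 5)) _ _ 4 (fact_finrank_euclideanSpace_succ 4))) N g :=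
    helper_rfg_roundPackage
  -- transport along `Φ`
  have htr := helper_rfg_transport (Metric.sphere (0 : EuclideanSpace ℝ (Fin 5)) 1)
    ((@roundMetric (EuclideanSpace ℝ (Fin 5)) _ _ 4 (fact_finrank_euclideanSpace_succ 4)).toContMDiffRiemannianMetric
      (@isRiemannian_roundMetric (EuclideanSpace ℝ (Fin 5)) _ _ 4 (fact_finrank_euclideanSpace_succ 4)))
    M g4 Φ (fun x X Y => hΦ x X Y) hpkg
  obtain ⟨N, i1, i2, i3, i4, i5, g5, iLC, hRic, hCC⟩ := htr
  exact ⟨N, i1, i2, i3, i4, i5, g5, iLC, hRic, hCC⟩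

end Summit.SmoothPoincare4.SmoothPoincare4.Cruxes.PEFillNearRound.RoundFilled

end
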